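import Summits.HodgeConjecture.CorCM.CMBalancedWeightSplitting
import Literature.FieldTheory.AlgClosed.AutFixedSubfield
import Literature.NumberTheory.EllipticCurves.LatticeInclusionRigidityProofs
import HarnessLib

/-!
# The imaginary quadratic multiplication `√-d` cut out by a Weil section

Cell `pub-hodgecm2` (COR-CM), count-neutral sub-row A3-CM45-products, file 2a.  HONEST FRAMING: structure theorems
about products of CM abelian varieties; no case of the Hodge conjecture is proved here and `HC_CM` is never
asserted.

Setting: a finite family of realisations `(A_i, ι_i, θ_i)` of CM types `Φ_i` of CM fields `K_i` read on `H¹`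
(`ComplexMultiplication.IsCMTypeRealisation`), their product `B = ⨁_i A_i`, and the index set
`⊔_i Hom(K_i, ℂ)` with its `Aut(ℂ)`-action (`τ • (i, s) = (i, τ ∘ s)`, `ρ = starRingAut` = complex conjugation;
`CorCM/CMBalancedWeightSplitting`).  A «WEIL SECTION» is a weight `S ⊆ ⊔_i Hom(K_i, ℂ)` containing no conjugate
pair, meeting every conjugate pair, and with `τ • S ∈ {S, ρ • S}` for every `τ ∈ Aut(ℂ)` (the second horn of the
dichotomy `CMWeights.mem_pohlmannDivisorSetsAlg_two_or_weilSection`).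

* `exists_ringOfIntegers_sum_mul_apply_ne_zero` — Dedekind/Artin independence of the complex embeddings of a number
  field, in the form «some algebraic INTEGER `α` has `Σ_s c_s s(α) ≠ 0`» (`linearIndependent_monoidHom` + the
  integral basis);
* `exists_intCast_eq_of_forall_ringEquiv` — an `Aut(ℂ)`-fixed algebraic integer of `ℂ` is a rational integer;
* **`exists_sqrt_neg_of_weilSection`** — from a Weil section `S`: an integer `d ≥ 1` and `a_i ∈ 𝓞_{K_i}` with
  `s(a_i) = i√d` for `(i, s) ∈ S` and `s(a_i) = -i√d` otherwise (so `a_i² = -d`): the signed trace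
  `δ = Σ_s ± s(α)` over ONE block transforms under `Aut(ℂ)` by the sign character of `S`, is purely imaginary,
  `δ² ∈ ℤ_{<0}`, and `δ ∈ s(K_i)` for every `(i, s) ∈ S` by the fixed-field property of `Aut(ℂ/s(K_i))`
  (`Complex.mem_subfield_of_forall_ringEquiv`) — i.e. ONE imaginary quadratic field `ℚ(√-d)` embedded compatibly in
  every `K_i`, acting on `B` through `φ_S = ⊕_i ι_i(a_i)`;
* sequel `CorCM/CMWeilSectionEndomorphism`: `φ_S ≫ φ_S = -(d • 𝟙 B)` and the weight line `H^{2m}(B)_S` lies in the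
  `+`-Weil eigen-line `weilClassesPlus B φ_S m d` (van Geemen 4.9); consumer `CorCM/CMProductFourfoldsOfMarkman`.

## References

* [vanGeemen1994HodgeAV] B. van Geemen, *An introduction to the Hodge conjecture for abelian varieties*, LNM 1594, 4.9,
  proof of Thm. 6.12.
* [MoonenZarhin1999LowDim] B. Moonen, Yu. Zarhin, Math. Ann. 315 (1999), Thm. 0.1 and (1.9).
* [Milne2020HodgeClassesAV] J. S. Milne, *Hodge classes on abelian varieties* (2020), 1.2 (a).
* [Cox2013] D. A. Cox, *Galois Theory*, 2nd ed., §10.C (conjugates under `Aut(ℂ)`).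
-/

noncomputable section

open CategoryTheory CategoryTheory.Limits NumberField

namespace Summit.HodgeConjecture.CorCM.CMWeights

open Literature.AlgebraicGeometry.Motives (AbelianVariety CMType IsSmoothProjective ComplexPoints)
open Literature.AlgebraicGeometry.HodgeTheory
open Literature.AlgebraicGeometry.Pohlmann1968
open Literature.AlgebraicGeometry.ComplexMultiplication (IsCMTypeRealisation)
open Literature.AlgebraicTopology.SingularHomology
open Literature.NumberTheory.ComplexMultiplication
open Literature.FieldTheory.AlgClosed

open scoped Classical Pointwise

/-! ### §1 Descent over `Aut(ℂ)` and independence of embeddings -/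

section Descent

/-- **An `Aut(ℂ)`-fixed algebraic integer of `ℂ` is a rational integer** (rational by the tree's
`EllipticCurves.exists_ratCast_eq_of_forall_ringEquiv`, and `ℤ` is integrally closed). [folklore] -/
theorem exists_intCast_eq_of_forall_ringEquiv {x : ℂ} (h : ∀ σ : ℂ ≃+* ℂ, σ x = x) (hx : IsIntegral ℤ x) :
    ∃ m : ℤ, (m : ℂ) = x := by
  obtain ⟨q, rfl⟩ := Literature.NumberTheory.EllipticCurves.exists_ratCast_eq_of_forall_ringEquiv h
  have hq : IsIntegral ℤ q := by
    have e : (algebraMap ℚ ℂ).toIntAlgHom q = (q : ℂ) := rfl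
    rw [← e] at hx
    exact (isIntegral_algHom_iff _ (algebraMap ℚ ℂ).injective).1 hx
  obtain ⟨m, hm⟩ := (IsIntegrallyClosed.isIntegral_iff (R := ℤ) (K := ℚ)).1 hq
  exact ⟨m, by rw [← hm]; simp⟩

/-- **Independence of the complex embeddings of a number field, integral form**: if the coefficients `c_s`
(`s : K → ℂ`) are not all zero, some algebraic INTEGER `α ∈ 𝓞_K` has `Σ_s c_s · s(α) ≠ 0` (Dedekind–Artin
independence of characters, Mathlib `linearIndependent_monoidHom`, and `𝓞_K` spans `K` over `ℚ`). [folklore] -/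
theorem exists_ringOfIntegers_sum_mul_apply_ne_zero {K : Type} [Field K] [NumberField K] (c : (K →+* ℂ) → ℂ)
    (hc : c ≠ 0) : ∃ α : 𝓞 K, ∑ s, c s * s (α : K) ≠ 0 := by
  by_contra h
  simp only [not_exists, not_not] at h
  -- the relation holds on all of `K` (integral basis)
  have key : ∀ β : K, ∑ s : K →+* ℂ, c s * s β = 0 := by
    intro β
    rw [← (integralBasis K).sum_repr β]
    simp only [map_sum, Finset.mul_sum]
    rw [Finset.sum_comm]
    refine Finset.sum_eq_zero fun j _ => ?_
    have hj := h (RingOfIntegers.basis K j)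
    have e : ∀ s : K →+* ℂ, c s * s (((integralBasis K).repr β j) • integralBasis K j) =
        ((integralBasis K).repr β j : ℂ) * (c s * s (RingOfIntegers.basis K j : K)) := by
      intro s
      rw [map_rat_smul, Rat.smul_def, integralBasis_apply]
      change c s * (((integralBasis K).repr β j : ℂ) * s (RingOfIntegers.basis K j : K)) = _
      ring
    simp_rw [e]
    rw [← Finset.mul_sum, hj, mul_zero]
  -- independence of the embeddings as functions `K → ℂ`
  have hli : LinearIndependent ℂ (fun s : K →+* ℂ => ((s.toMonoidHom : K →* ℂ) : K → ℂ)) :=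
    (linearIndependent_monoidHom K ℂ).comp (fun s : K →+* ℂ => s.toMonoidHom) fun s t hst =>
      RingHom.ext fun x => by simpa using DFunLike.congr_fun hst x
  have hsum : ∑ s : K →+* ℂ, c s • ((s.toMonoidHom : K →* ℂ) : K → ℂ) = 0 := by
    funext β
    simpa [Finset.sum_apply, Pi.smul_apply, smul_eq_mul] using key β
  exact hc (funext fun s => Fintype.linearIndependent_iff.1 hli c hsum s)

end Descent

/-! ### §2 The element `√-d` cut out by a Weil section -/

section WeilSection

variable {n : ℕ} {K : Fin n → Type} [∀ i, Field (K i)] [∀ i, NumberField (K i)]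

/-- A number field is countable (a finite-dimensional `ℚ`-vector space). [folklore] -/
theorem countable_field (i : Fin n) : Countable (K i) :=
  Countable.of_equiv _ (Module.finBasis ℚ (K i)).equivFun.toEquiv.symm

omit [∀ i, NumberField (K i)] in
/-- For a Weil section `S`, a translate `τ • S` meeting `S` equals `S` (the alternative `τ • S = ρ • S` would put a
conjugate pair inside `S`). [folklore] -/
theorem smul_finset_eq_of_mem_of_weilSection {S : Finset ((i : Fin n) × (K i →+* ℂ))}
    (hsec : ∀ x ∈ S, (starRingAut : ℂ ≃+* ℂ) • x ∉ S)
    (hW : ∀ τ : ℂ ≃+* ℂ, τ • S = S ∨ τ • S = (starRingAut : ℂ ≃+* ℂ) • S)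
    {τ : ℂ ≃+* ℂ} {x : (i : Fin n) × (K i →+* ℂ)} (hx : x ∈ S) (hτx : τ • x ∈ S) : τ • S = S := by
  rcases hW τ with h | h
  · exact h
  · exfalso
    have hmem : τ • x ∈ (starRingAut : ℂ ≃+* ℂ) • S := h ▸ Finset.smul_mem_smul_finset hx
    obtain ⟨y, hy, hyx⟩ := Finset.mem_smul_finset.1 hmem
    have : (starRingAut : ℂ ≃+* ℂ) • (τ • x) = y := by rw [← hyx, conj_smul_conj_smul]
    exact hsec (τ • x) hτx (this ▸ hy)

omit [∀ i, NumberField (K i)] in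
/-- For a nonempty Weil section, `ρ • S ≠ S`. [folklore] -/
theorem conj_smul_finset_ne_of_weilSection {S : Finset ((i : Fin n) × (K i →+* ℂ))} (hS0 : S.Nonempty)
    (hsec : ∀ x ∈ S, (starRingAut : ℂ ≃+* ℂ) • x ∉ S) : (starRingAut : ℂ ≃+* ℂ) • S ≠ S := by
  obtain ⟨x, hx⟩ := hS0
  intro h
  exact hsec x hx (h ▸ Finset.smul_mem_smul_finset hx)

/-- **The sign character of a Weil section and its signed trace.**  For a Weil section `S`, a block `i₀` and
`α ∈ 𝓞_{K_{i₀}}`, the signed trace `δ = Σ_s ε_s s(α)` (`ε_s = 1` if `(i₀, s) ∈ S`, `-1` otherwise) satisfies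
`τ(δ) = δ` when `τ • S = S` and `τ(δ) = -δ` when `τ • S = ρ • S` (reindex the sum by `s ↦ τ • s`).
[folklore] -/
theorem ringEquiv_apply_signedTrace {S : Finset ((i : Fin n) × (K i →+* ℂ))}
    (hsec : ∀ x ∈ S, (starRingAut : ℂ ≃+* ℂ) • x ∉ S)
    (hfull : ∀ x : (i : Fin n) × (K i →+* ℂ), x ∈ S ∨ (starRingAut : ℂ ≃+* ℂ) • x ∈ S)
    (i₀ : Fin n) (α : K i₀) (τ : ℂ ≃+* ℂ) :
    (τ • S = S → τ (∑ s : K i₀ →+* ℂ, (if (⟨i₀, s⟩ : (i : Fin n) × (K i →+* ℂ)) ∈ S then (1 : ℂ) else -1) * s α) =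
      ∑ s : K i₀ →+* ℂ, (if (⟨i₀, s⟩ : (i : Fin n) × (K i →+* ℂ)) ∈ S then (1 : ℂ) else -1) * s α) ∧
    (τ • S = (starRingAut : ℂ ≃+* ℂ) • S →
      τ (∑ s : K i₀ →+* ℂ, (if (⟨i₀, s⟩ : (i : Fin n) × (K i →+* ℂ)) ∈ S then (1 : ℂ) else -1) * s α) =
      -∑ s : K i₀ →+* ℂ, (if (⟨i₀, s⟩ : (i : Fin n) × (K i →+* ℂ)) ∈ S then (1 : ℂ) else -1) * s α) := by
  -- `τ` applied to the sum, reindexed by `s ↦ τ • s`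
  have hτsum : τ (∑ s : K i₀ →+* ℂ, (if (⟨i₀, s⟩ : (i : Fin n) × (K i →+* ℂ)) ∈ S then (1 : ℂ) else -1) * s α) =
      ∑ s : K i₀ →+* ℂ, (if (⟨i₀, τ⁻¹ • s⟩ : (i : Fin n) × (K i →+* ℂ)) ∈ S then (1 : ℂ) else -1) * s α := by
    rw [map_sum]
    rw [← Equiv.sum_comp (MulAction.toPerm τ : Equiv.Perm (K i₀ →+* ℂ))
      (fun s => (if (⟨i₀, τ⁻¹ • s⟩ : (i : Fin n) × (K i →+* ℂ)) ∈ S then (1 : ℂ) else -1) * s α)]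
    refine Finset.sum_congr rfl fun s _ => ?_
    simp only [MulAction.toPerm_apply, inv_smul_smul, map_mul]
    congr 1
    · split_ifs <;> simp
  have hmemτ : ∀ s : K i₀ →+* ℂ,
      ((⟨i₀, τ⁻¹ • s⟩ : (i : Fin n) × (K i →+* ℂ)) ∈ S ↔ (⟨i₀, s⟩ : (i : Fin n) × (K i →+* ℂ)) ∈ τ • S) := by
    intro s
    rw [← Finset.inv_smul_mem_iff]
    rfl
  constructor
  · intro hτS
    rw [hτsum]
    refine Finset.sum_congr rfl fun s _ => ?_
    by_cases hs : (⟨i₀, s⟩ : (i : Fin n) × (K i →+* ℂ)) ∈ S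
    · rw [if_pos hs, if_pos ((hmemτ s).2 (by rw [hτS]; exact hs))]
    · rw [if_neg hs, if_neg (fun h => hs (by have h' := (hmemτ s).1 h; rwa [hτS] at h'))]
  · intro hτS
    rw [hτsum, ← Finset.sum_neg_distrib]
    refine Finset.sum_congr rfl fun s _ => ?_
    have hflip : ((⟨i₀, τ⁻¹ • s⟩ : (i : Fin n) × (K i →+* ℂ)) ∈ S) ↔ (⟨i₀, s⟩ : (i : Fin n) × (K i →+* ℂ)) ∉ S := by
      rw [hmemτ s, hτS, ← Finset.inv_smul_mem_iff]
      have e : (starRingAut : ℂ ≃+* ℂ)⁻¹ • (⟨i₀, s⟩ : (i : Fin n) × (K i →+* ℂ)) =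
          (starRingAut : ℂ ≃+* ℂ) • (⟨i₀, s⟩ : (i : Fin n) × (K i →+* ℂ)) := by
        rw [inv_smul_eq_iff, conj_smul_conj_smul]
      rw [e]
      constructor
      · intro h1 h2
        exact hsec _ h2 h1
      · intro h1
        exact (hfull _).resolve_left h1
    by_cases hs : (⟨i₀, s⟩ : (i : Fin n) × (K i →+* ℂ)) ∈ S
    · rw [if_pos hs, if_neg (fun h => (hflip.1 h) hs)]
      ring
    · rw [if_neg hs, if_pos (hflip.2 hs)]
      ring

/-- **The imaginary quadratic element cut out by a Weil section.**  For a nonempty Weil section `S` of a family of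
CM fields `K_i`: there are `d ≥ 1` and `a_i ∈ 𝓞_{K_i}` with `s(a_i) = i√d` for `(i, s) ∈ S` and `s(a_i) = -i√d` for
`(i, s) ∉ S`; in particular `a_i² = -d` in every block — one imaginary quadratic field `ℚ(√-d)`, embedded in every
`K_i` compatibly with `S`.  (Signed trace over one block, `Aut(ℂ)`-equivariance by the sign character of `S`,
`δ² ∈ ℤ_{<0}` by descent, `δ ∈ s(K_i)` by the fixed field of `Aut(ℂ/s(K_i))`, transport to the other embeddings
by the transitivity of `Aut(ℂ)` on `Hom(K_i, ℂ)`.) [folklore] -/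
theorem exists_sqrt_neg_of_weilSection {S : Finset ((i : Fin n) × (K i →+* ℂ))} (hS0 : S.Nonempty)
    (hsec : ∀ x ∈ S, (starRingAut : ℂ ≃+* ℂ) • x ∉ S)
    (hfull : ∀ x : (i : Fin n) × (K i →+* ℂ), x ∈ S ∨ (starRingAut : ℂ ≃+* ℂ) • x ∈ S)
    (hW : ∀ τ : ℂ ≃+* ℂ, τ • S = S ∨ τ • S = (starRingAut : ℂ ≃+* ℂ) • S) :
    ∃ (d : ℕ) (a : ∀ i, 𝓞 (K i)), 0 < d ∧
      (∀ x : (i : Fin n) × (K i →+* ℂ), x ∈ S → x.2 (a x.1 : K x.1) = Complex.I * (Real.sqrt d : ℂ)) ∧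
      (∀ x : (i : Fin n) × (K i →+* ℂ), x ∉ S → x.2 (a x.1 : K x.1) = -(Complex.I * (Real.sqrt d : ℂ))) ∧
      ∀ i, (a i) * (a i) = -(d : 𝓞 (K i)) := by
  obtain ⟨⟨i₀, s₀⟩, hx₀⟩ := hS0
  -- the signed trace `δ₀`
  set ε : (K i₀ →+* ℂ) → ℂ := fun s => if (⟨i₀, s⟩ : (i : Fin n) × (K i →+* ℂ)) ∈ S then (1 : ℂ) else -1 with hε
  have hεne : ε ≠ 0 := fun h => by
    have h1 : ε s₀ = 0 := congrFun h s₀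
    rw [hε] at h1
    dsimp only at h1
    rw [if_pos hx₀] at h1
    exact one_ne_zero h1
  obtain ⟨α, hα⟩ := exists_ringOfIntegers_sum_mul_apply_ne_zero ε hεne
  set δ₀ : ℂ := ∑ s : K i₀ →+* ℂ, ε s * s (α : K i₀) with hδ₀
  have hρS : (starRingAut : ℂ ≃+* ℂ) • S ≠ S := conj_smul_finset_ne_of_weilSection ⟨_, hx₀⟩ hsec
  -- transformation under `Aut(ℂ)`
  have hfix : ∀ τ : ℂ ≃+* ℂ, τ • S = S → τ δ₀ = δ₀ := fun τ hτ =>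
    (ringEquiv_apply_signedTrace hsec hfull i₀ (α : K i₀) τ).1 hτ
  have hflip : ∀ τ : ℂ ≃+* ℂ, τ • S = (starRingAut : ℂ ≃+* ℂ) • S → τ δ₀ = -δ₀ := fun τ hτ =>
    (ringEquiv_apply_signedTrace hsec hfull i₀ (α : K i₀) τ).2 hτ
  have hsq_fix : ∀ τ : ℂ ≃+* ℂ, τ (δ₀ * δ₀) = δ₀ * δ₀ := by
    intro τ
    rw [map_mul]
    rcases hW τ with h | h
    · rw [hfix τ h]
    · rw [hflip τ h, neg_mul_neg]
  have hconj : starRingEnd ℂ δ₀ = -δ₀ := hflip starRingAut ((hW starRingAut).resolve_left hρS)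
  -- integrality
  have hδint : IsIntegral ℤ δ₀ := by
    refine IsIntegral.sum _ fun s _ => IsIntegral.mul ?_ ?_
    · rw [hε]
      dsimp only
      split_ifs
      · exact isIntegral_one
      · exact isIntegral_one.neg
    · exact (RingOfIntegers.isIntegral_coe α).map s.toIntAlgHom
  -- `δ₀² = -d`, `d ≥ 1`
  obtain ⟨m, hm⟩ := exists_intCast_eq_of_forall_ringEquiv hsq_fix (hδint.mul hδint)
  have hre : δ₀.re = 0 := by
    have := congrArg Complex.re hconj
    simp only [Complex.conj_re, Complex.neg_re] at this
    linarith
  have him : δ₀.im ≠ 0 := fun h => hα (Complex.ext (by simp [hre]) (by simp [h]))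
  have hm_eq : (m : ℝ) = -(δ₀.im * δ₀.im) := by
    have := congrArg Complex.re hm
    simp only [Complex.intCast_re, Complex.mul_re, hre, zero_mul, zero_sub] at this
    linarith
  have hm_neg : m < 0 := by
    have h1 : 0 < δ₀.im * δ₀.im := mul_self_pos.2 him
    have h2 : (m : ℝ) < 0 := by rw [hm_eq]; linarith
    exact_mod_cast h2
  set d : ℕ := (-m).toNat with hd
  have hd_pos : 0 < d := by omega
  have hmd : (m : ℂ) = -(d : ℂ) := by
    have : ((-m).toNat : ℤ) = -m := Int.toNat_of_nonneg (by omega)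
    have h' : (d : ℤ) = -m := by rw [hd]; exact this
    have h'' : (m : ℤ) = -(d : ℤ) := by omega
    exact_mod_cast congrArg (fun z : ℤ => (z : ℂ)) h''
  have hδ₀sq : δ₀ * δ₀ = -(d : ℂ) := by rw [← hm, hmd]
  -- normalise the sign: `δ = i√d`
  set δ : ℂ := if 0 < δ₀.im then δ₀ else -δ₀ with hδdef
  have hδ_or : δ = δ₀ ∨ δ = -δ₀ := by rw [hδdef]; split_ifs <;> simp
  have hδ_eq : δ = Complex.I * (Real.sqrt d : ℂ) := by
    have hdim : δ.im * δ.im = d ∧ 0 < δ.im ∧ δ.re = 0 := by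
      have hsq : δ₀.im * δ₀.im = d := by
        have := congrArg Complex.re hδ₀sq
        simp only [Complex.mul_re, hre, zero_mul, zero_sub, Complex.neg_re, Complex.natCast_re] at this
        linarith
      rw [hδdef]
      split_ifs with h
      · exact ⟨hsq, h, hre⟩
      · refine ⟨by simpa using hsq, ?_, by simp [hre]⟩
        simp only [Complex.neg_im, Left.neg_pos_iff]
        exact lt_of_le_of_ne (not_lt.1 h) him
    obtain ⟨h1, h2, h3⟩ := hdim
    have h4 : δ.im = Real.sqrt d := by
      rw [eq_comm, Real.sqrt_eq_iff_mul_self_eq_of_pos h2]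
      exact h1
    refine Complex.ext ?_ ?_
    · simp [h3]
    · simp [h4]
  have hδfix : ∀ τ : ℂ ≃+* ℂ, τ • S = S → τ δ = δ := fun τ hτ => by
    rcases hδ_or with h | h
    · rw [h, hfix τ hτ]
    · rw [h, map_neg, hfix τ hτ]
  have hδint' : IsIntegral ℤ δ := by
    rcases hδ_or with h | h
    · rw [h]; exact hδint
    · rw [h]; exact hδint.neg
  have hδsq : δ * δ = -(d : ℂ) := by
    rcases hδ_or with h | h
    · rw [h, hδ₀sq]
    · rw [h, neg_mul_neg, hδ₀sq]
  -- a base embedding in `S` for every block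
  have hSi : ∀ i : Fin n, ∃ s : K i →+* ℂ, (⟨i, s⟩ : (i : Fin n) × (K i →+* ℂ)) ∈ S := by
    intro i
    obtain ⟨s⟩ : Nonempty (K i →+* ℂ) := inferInstance
    rcases hfull ⟨i, s⟩ with h | h
    · exact ⟨s, h⟩
    · refine ⟨ComplexEmbedding.conjugate s, ?_⟩
      rw [conj_smul_sigma_eq] at h
      exact h
  choose sI hsI using hSi
  -- `δ ∈ sI i (K i)` by the fixed field of `Aut(ℂ / sI i (K i))`
  have hδmem : ∀ i, δ ∈ (sI i).fieldRange := by
    intro i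
    haveI : Countable (K i) := countable_field i
    have hcount : Cardinal.mk (sI i).fieldRange ≤ Cardinal.aleph0 := by
      have hc : ((sI i).fieldRange : Set ℂ).Countable := by
        rw [RingHom.coe_fieldRange]
        exact Set.countable_range _
      haveI : Countable (sI i).fieldRange := hc.to_subtype
      exact Cardinal.mk_le_aleph0
    refine Complex.mem_subfield_of_forall_ringEquiv (sI i).fieldRange hcount fun σ hσ => ?_
    have hσs : σ • sI i = sI i := RingHom.ext fun b => hσ _ ((sI i).mem_fieldRange.2 ⟨b, rfl⟩)
    have hσx : σ • (⟨i, sI i⟩ : (i : Fin n) × (K i →+* ℂ)) ∈ S := by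
      rw [smul_sigma_eq]
      change (⟨i, σ • sI i⟩ : (i : Fin n) × (K i →+* ℂ)) ∈ S
      rw [hσs]
      exact hsI i
    exact hδfix σ (smul_finset_eq_of_mem_of_weilSection hsec hW (hsI i) hσx)
  have haex : ∀ i, ∃ a : 𝓞 (K i), sI i (a : K i) = δ := by
    intro i
    obtain ⟨b, hb⟩ := (sI i).mem_fieldRange.1 (hδmem i)
    have hbint : IsIntegral ℤ b := by
      rw [← hb] at hδint'
      exact (isIntegral_algHom_iff (sI i).toIntAlgHom (sI i).injective).1 hδint'
    exact ⟨⟨b, hbint⟩, hb⟩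
  choose a ha using haex
  -- values on all embeddings
  have hval : ∀ x : (i : Fin n) × (K i →+* ℂ), x ∈ S → x.2 (a x.1 : K x.1) = δ := by
    rintro ⟨i, s⟩ hs
    haveI : Countable (K i) := countable_field i
    obtain ⟨τ, hτ⟩ := Literature.AlgebraicGeometry.Motives.ZarhinLie.exists_ringEquiv_complex_comp_eq (sI i) s
    have hτs : τ • sI i = s := RingHom.ext fun b => hτ b
    have hτx : τ • (⟨i, sI i⟩ : (i : Fin n) × (K i →+* ℂ)) ∈ S := by
      rw [smul_sigma_eq]
      change (⟨i, τ • sI i⟩ : (i : Fin n) × (K i →+* ℂ)) ∈ S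
      rw [hτs]
      exact hs
    have hτS := smul_finset_eq_of_mem_of_weilSection hsec hW (hsI i) hτx
    change s (a i : K i) = δ
    rw [← hτ, ha i, hδfix τ hτS]
  have hval' : ∀ x : (i : Fin n) × (K i →+* ℂ), x ∉ S → x.2 (a x.1 : K x.1) = -δ := by
    rintro ⟨i, s⟩ hs
    have hcs : (starRingAut : ℂ ≃+* ℂ) • (⟨i, s⟩ : (i : Fin n) × (K i →+* ℂ)) ∈ S := (hfull _).resolve_left hs
    have h1 := hval _ hcs
    rw [conj_smul_sigma_eq] at h1
    change ComplexEmbedding.conjugate s (a i : K i) = δ at h1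
    rw [ComplexEmbedding.conjugate_coe_eq] at h1
    change s (a i : K i) = -δ
    have h2 : s (a i : K i) = starRingEnd ℂ δ := by rw [← h1, starRingEnd_self_apply]
    rw [h2]
    have hδconj : starRingEnd ℂ δ = -δ := by
      rw [hδ_eq]
      simp [Complex.conj_ofReal]
    exact hδconj
  refine ⟨d, a, hd_pos, fun x hx => by rw [hval x hx, hδ_eq], fun x hx => by rw [hval' x hx, hδ_eq], fun i => ?_⟩
  -- `a_i² = -d`
  apply RingOfIntegers.eq_iff.1
  apply (sI i).injective
  change sI i (algebraMap (𝓞 (K i)) (K i) (a i * a i)) = sI i (algebraMap (𝓞 (K i)) (K i) (-(d : 𝓞 (K i))))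
  rw [map_mul, map_mul, map_neg, map_natCast, map_neg, map_natCast]
  change sI i (a i : K i) * sI i (a i : K i) = _
  rw [ha i, hδsq]

end WeilSection

end Summit.HodgeConjecture.CorCM.CMWeights

end
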